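import Summits.QuantumFields.YangMills.Theorems.UnitScaleTiltProp7StubEXOfDisplayedRows
import Summits.QuantumFields.YangMills.Theorems.UnitScaleTiltProp7Chart47T3
import Summits.QuantumFields.YangMills.Theorems.UnitScaleTiltProp7ChartSigmaT3OfRegPr
import HarnessLib

/-!
# Route `UnitScaleTilt`, crux K1 child «MinimiserStabilityRegPr» (stmt-QuantumFields-19200), skeleton v10, stub `stub_existenceMinimalOrbit` (EX), route (α) — **(CH-KNIT)**:
# the CHART-112 binder `hChart` of `stubEX_of_displayedRows` (p599501) DISCHARGED FROM THE PIECES — ★w1-19200 g2's PROVED Prop.-3 chart `Prop7ChartT3.chart47T3_of_regPr`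
# (letter `H` with (46) displayed), ★w5-20520 g0's PROVED Σ_k bridge `Prop7ChartSigmaT3OfRegPr.chartSigmaT3_of_regPr`, and the displayed remainder `Chart5T3`-with-EL
# ((112) ∘ Prop. 5 ∘ (123)–(140) ∘ PIN-B ∘ E–L) — so the registered stub text now reads, as ONE kernel statement, on {N06(d = 3) ×2 + (46), Prop. 4, (1.37),
# CHART-47∕Σ WINDOWS, CHART-5+EL, (γ)-growth, Thm2TorusAt}

Cell `ym3-torus`, width seat `ym-ust-19200-w2` (gen 2; OWNER W-SEAT MAP pass #3 row M1 (CH-KNIT), 03:17Z).  THEOREMS ONLY (0 `def`, 0 `sorry`).  CONDITIONAL: the stub stays OPEN.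
YM₃ on T³ is a ladder rung (R3), not the Clay problem; nothing here claims the stub, the crux, d = 4 or the mass gap.  `--supports stmt-QuantumFields-19200 --as helper`.

THE KNIT (no new analysis).  Member by member (`i = (F, n, K)`, `B₃* = 3L`, background radius `a = L³·3L·ε₁ ≤ α`): `RegPr a U₀ ⟹ RegPr α U₀` (`regPr_mono`) ⟹
`Chart47T3 F n K α ε_i U₀ H` (★w1's port of [Balaban1985Variational] Prop. 3 from `B11Prop3Concrete.prop3_concrete`, in its windows at `(α, b_i, ε_i, B_H)` — member-wise
because `L^{K−n}` enters `b`, `ε₃`, `C₂`) and `ChartSigmaT3 F n K e U₀` (★w5's (1.29)-restricted axial fixing, in its windows at `(α, e)`); the displayed `Chart5T3`-text WITH the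
E–L conjunct (OWNER 02:21:57Z: «CHART-112 CARRIES THE FIFTH CONJUNCT … in the split, the EL conjunct belongs to `Chart5T3`'s side») turns a solution `A₁` of (111) in the
(115)-ball `r` into the exponent `X` with (19)-size `≤ M(‖A₁‖ + ‖H₁B‖) < M(r + 2B₀α) < e` (‖H₁B‖ ≤ B₀·|B| < B₀·2·3L·L³ε₁ ≤ 2B₀α by `norm_H₁` ∘ `bound20`), (21), the fibre
clause and EL; `ChartSigmaT3` at that size gives the restricted axial `u`, the fibre clause puts `(e^{iX}U₀)^u` in `𝔅_k(V)` — i.e. (20) `AvgCondPrint` — exactly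
★w1's `chart112_of_chart47_chartSigma_chart5` with the EL conjunct threaded (`hChart_of_pieces`).  Then `stubEX_of_displayedRows` at the chart of record
(`Pd := periodsT3`, `e := siteEquiv`, `he := siteEquiv_shiftEquiv`; background `bgOfCfg` by `rfl`).

DISPLAYED ROWS of ★★★ **`stubEX_of_chartPieces`** (everything else is a kernel theorem of the tree): (N06) `norm_G`, `norm_H₁`; (46) `hH` (‖HX‖ ≤ B_H‖X‖,
[Balaban1985BackgroundPropagators] Thm 3.12); (P4) `prop4`; (B20) `bound20`; (W47) `hw47` = the eight numeric windows of `chart47T3_of_regPr` VERBATIM at `(α L, bf L i, εf L i, BH L)`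
([Balaban1985Averaging] Props 4–5 regime + print's «ε₃ sufficiently small»; located: pure-`L` members of (145)∕(155) fail for small `L` — (GEO-L5)-type sub-gap); (WΣ) `hwΣ` = the nine
windows of `chartSigmaT3_of_regPr` VERBATIM at `(α L, ef L)`; (WMe) `M(r + 2B₀α) < e`; (CH5EL) `h5EL` = ★w1's `Chart5T3` text (XL: (112), Prop. 5, (123)–(140), PIN-B) + EL;
(GR) `hGrowth` (γ-input, pinned form); (T2) `hThm2`.  Conclusion: the REGISTERED text of `stub_existenceMinimalOrbit` VERBATIM.

References: T. Bałaban, CMP 102 (1985) 277–309 [Balaban1985Variational] (Prop. 3 p.289, (47)–(49) p.285, Prop. 5 p.294, (112) p.294, (123)–(142) pp.296–299, Prop. 7 p.299);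
CMP 99 (1985) 75–102 [Balaban1985RegularSpaces] ((1.19) p.79, (1.29) p.81, (1.37) p.82, Thm 2 p.83); CMP 98 (1985) 17–51 [Balaban1985Averaging] (Props 4–5 pp.38–42).
-/

set_option autoImplicit false

noncomputable section

open scoped BigOperators Matrix.Norms.L2Operator Matrix

namespace Summit.QuantumFields.YangMills.Theorems.Prop7StubEXOfChartPieces

open Literature.MathematicalPhysics.QuantumFieldTheory.Balaban1983to89
open Literature.MathematicalPhysics.QuantumFieldTheory.Balaban1983to89.T3ContinuumYM3Torus
open Literature.MathematicalPhysics.QuantumFieldTheory.Balaban1983to89.T3UnitLawDensityEML (ℰp)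
open Literature.MathematicalPhysics.QuantumFieldTheory.Balaban1983to89.T3ConstrainedMinimiser (fibre)
open Literature.MathematicalPhysics.QuantumFieldTheory.Balaban1983to89.T3PrintedRegularMinimiser (RegPr regFibrePr)
open Literature.MathematicalPhysics.QuantumFieldTheory.Balaban1983to89.T3PrintedRegularOrbits (descTransf)
open Literature.MathematicalPhysics.QuantumFieldTheory.Balaban1983to89.T3PrintedMinimiserExistence (regPr_mono)
open Literature.MathematicalPhysics.QuantumFieldTheory.Balaban1983to89.T3Thm1Carrier
open Literature.MathematicalPhysics.QuantumFieldTheory.Balaban1983to89.T3SectALandauChart (In19 emb15 CloseAvg eta)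
open BlockAveragingEMLLinearisedBackground (pertVar)
open B4Sect5Torus (TSite)
open B9SectCLatticeCarrier (Bond)
open B10Eq27TorusAxialLog (unitsField toUField)
open B11Eq115Space (NegSize Space115)
open B11Eq111FrakG (nabla115)
open B11Eq98CurrentSlot (Jcur)
open B13Contraction113 (QuadAnalytic)
open B8Thm2TorusAt (Thm2TorusAt)
open B7Prop2SpecialUnitary (specialUnitaryUnits)
open B7Prop2Explicit (C0 c2')
open B7Prop3Flat (c3)
open B7Prop5GeneralLevels (thetaGen C3Gen)
open Summit.QuantumFields.YangMills.Theorems.Prop7TPrint (nMax19 expHermField expHermField_apply coe_expHerm)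
open Summit.QuantumFields.YangMills.Theorems.Prop7SPrint (AvgCondPrint IsLandauPrint RestrictedPrint IsAxialPrint)
open Summit.QuantumFields.YangMills.Theorems.Prop7SectET3Transport (periodsT3 siteEquiv siteEquiv_shiftEquiv bgOfCfg)
open Summit.QuantumFields.YangMills.Theorems.Prop7ChartT3 (coarseBox C2K Chart47T3 ChartSigmaT3 chart47T3_of_regPr)
open Summit.QuantumFields.YangMills.Theorems.Prop7ChartSigmaT3OfRegPr (chartSigmaT3_of_regPr)
open Summit.QuantumFields.YangMills.Theorems.Prop7StubEXOfDisplayedRows (stubEX_of_displayedRows)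

/-! ## §1 Member level: CHART-112 with EL from CHART-47 ∧ CHART-Σ ∧ (CHART-5 + EL) — ★w1's `chart112_of_chart47_chartSigma_chart5` with the EL conjunct threaded -/

/-- **CHART-112 (five conjuncts) FROM THE PIECES, one member**: Prop. 3's chart `Chart47T3 … a ε U₀ H`, the Σ_k-bridge `ChartSigmaT3 … e U₀`, the displayed Prop.-5 row WITH
E–L (same text as `Prop7ChartT3.Chart5T3` plus the EL clause), `0 ≤ M` and the size window `M(ε₄ + ‖H₁B‖) < e` give, for every solution `A₁` of (111) in the (115)-ball `ε₄`, the
exponent `X`: Hermitian-traceless, `nMax19 ≤ M(‖A₁‖ + ‖H₁B‖)`, (20) `AvgCondPrint` (the restricted axial `u` of CHART-Σ + the fibre clause of CHART-5), (21), and EL at its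
restricted axial representatives in the fibre. [cite: Balaban1985Variational, (112) p.294, Prop. 5 p.294, p.299; Balaban1985RegularSpaces, (1.29) p.81] -/
theorem hChart_of_pieces (F : T3Family) {n K : ℕ} (h : n ≤ K) [Fact (0 < (F.L : ℝ))] [Fact (0 < ((F.L : ℝ)⁻¹) ^ (K - n))] {ε₄ M e a ε : ℝ}
    {V : GaugeField (F.P n) 0 (Matrix.specialUnitaryGroup (Fin 2) ℂ)} {U₀ : GaugeField (F.P K) 0 (Matrix.specialUnitaryGroup (Fin 2) ℂ)}
    {𝒢 : NegSize (F.L : ℝ) (((F.L : ℝ)⁻¹) ^ (K - n)) (fun _ : Bond 3 (periodsT3 F K) => K - n) 3 (Matrix (Fin 2) (Fin 2) ℂ) →L[ℂ]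
          Space115 (F.L : ℝ) (((F.L : ℝ)⁻¹) ^ (K - n)) (fun _ : Bond 3 (periodsT3 F K) => K - n) (fun _ : Bond 3 (periodsT3 F K) × Fin 3 => K - n)
            (nabla115 (((F.L : ℝ)⁻¹) ^ (K - n)) (bgOfCfg F K U₀))}
    {W : Space115 (F.L : ℝ) (((F.L : ℝ)⁻¹) ^ (K - n)) (fun _ : Bond 3 (periodsT3 F K) => K - n) (fun _ : Bond 3 (periodsT3 F K) × Fin 3 => K - n)
            (nabla115 (((F.L : ℝ)⁻¹) ^ (K - n)) (bgOfCfg F K U₀)) →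
          NegSize (F.L : ℝ) (((F.L : ℝ)⁻¹) ^ (K - n)) (fun _ : Bond 3 (periodsT3 F K) => K - n) 3 (Matrix (Fin 2) (Fin 2) ℂ)}
    {β : Type} [Fintype β]
    {H₁ : (β → Matrix (Fin 2) (Fin 2) ℂ) →L[ℂ]
          Space115 (F.L : ℝ) (((F.L : ℝ)⁻¹) ^ (K - n)) (fun _ : Bond 3 (periodsT3 F K) => K - n) (fun _ : Bond 3 (periodsT3 F K) × Fin 3 => K - n)
            (nabla115 (((F.L : ℝ)⁻¹) ^ (K - n)) (bgOfCfg F K U₀))}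
    {B : β → Matrix (Fin 2) (Fin 2) ℂ}
    {H : (↥(coarseBox F n K) → Matrix (Fin 2) (Fin 2) ℂ) →ₗ[ℂ] (PBond (F.P K) 0 → Matrix (Fin 2) (Fin 2) ℂ)}
    (h47 : Chart47T3 F n K a ε U₀ H) (hSig : ChartSigmaT3 F n K e U₀)
    (h5EL : Chart47T3 F n K a ε U₀ H →
      ∀ A₁ : Space115 (F.L : ℝ) (((F.L : ℝ)⁻¹) ^ (K - n)) (fun _ : Bond 3 (periodsT3 F K) => K - n) (fun _ : Bond 3 (periodsT3 F K) × Fin 3 => K - n)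
            (nabla115 (((F.L : ℝ)⁻¹) ^ (K - n)) (bgOfCfg F K U₀)),
        ‖A₁‖ < ε₄ → A₁ + 𝒢 (Jcur (bgOfCfg F K U₀)) + 𝒢 (W (A₁ + H₁ B)) = 0 →
          ∃ X : PBond (F.P K) 0 → Matrix (Fin 2) (Fin 2) ℂ,
            (∀ b : PBond (F.P K) 0, (X b).IsHermitian ∧ Matrix.trace (X b) = 0) ∧
            nMax19 F n K U₀ X ≤ M * (‖A₁‖ + ‖H₁ B‖) ∧ IsLandauPrint F n K U₀ X ∧
            (∀ u : GaugeTransf (F.P K) 0 (Matrix.specialUnitaryGroup (Fin 2) ℂ), RestrictedPrint F n K U₀ u →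
              IsAxialPrint F n K U₀ (GaugeField.gaugeAct u (emb15 U₀ (expHermField X))) →
                GaugeField.gaugeAct u (emb15 U₀ (expHermField X)) ∈ fibre F ℰp n K h V) ∧
            (∀ u : GaugeTransf (F.P K) 0 (Matrix.specialUnitaryGroup (Fin 2) ℂ), RestrictedPrint F n K U₀ u →
              GaugeField.gaugeAct u (emb15 U₀ (expHermField X)) ∈ fibre F ℰp n K h V →
              ∀ γ : ℝ → GaugeField (F.P K) 0 (Matrix.specialUnitaryGroup (Fin 2) ℂ), γ 0 = GaugeField.gaugeAct u (emb15 U₀ (expHermField X)) →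
                (∀ t, γ t ∈ fibre F ℰp n K h V) →
                (∀ b, DifferentiableAt ℝ (fun t => ((γ t b : Matrix.specialUnitaryGroup (Fin 2) ℂ) : Matrix (Fin 2) (Fin 2) ℂ)) 0) →
                  deriv (fun t => wilsonAction4 (γ t)) 0 = 0))
    (hM : 0 ≤ M) (hMe : M * (ε₄ + ‖H₁ B‖) < e) :
    ∀ A₁ : Space115 (F.L : ℝ) (((F.L : ℝ)⁻¹) ^ (K - n)) (fun _ : Bond 3 (periodsT3 F K) => K - n) (fun _ : Bond 3 (periodsT3 F K) × Fin 3 => K - n)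
          (nabla115 (((F.L : ℝ)⁻¹) ^ (K - n)) (bgOfCfg F K U₀)),
      ‖A₁‖ < ε₄ → A₁ + 𝒢 (Jcur (bgOfCfg F K U₀)) + 𝒢 (W (A₁ + H₁ B)) = 0 →
        ∃ X : PBond (F.P K) 0 → Matrix (Fin 2) (Fin 2) ℂ,
          (∀ b : PBond (F.P K) 0, (X b).IsHermitian ∧ Matrix.trace (X b) = 0) ∧
          nMax19 F n K U₀ X ≤ M * (‖A₁‖ + ‖H₁ B‖) ∧ AvgCondPrint F n K h V U₀ X ∧ IsLandauPrint F n K U₀ X ∧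
          (∀ u : GaugeTransf (F.P K) 0 (Matrix.specialUnitaryGroup (Fin 2) ℂ), RestrictedPrint F n K U₀ u →
            GaugeField.gaugeAct u (emb15 U₀ (expHermField X)) ∈ fibre F ℰp n K h V →
            ∀ γ : ℝ → GaugeField (F.P K) 0 (Matrix.specialUnitaryGroup (Fin 2) ℂ), γ 0 = GaugeField.gaugeAct u (emb15 U₀ (expHermField X)) →
              (∀ t, γ t ∈ fibre F ℰp n K h V) →
              (∀ b, DifferentiableAt ℝ (fun t => ((γ t b : Matrix.specialUnitaryGroup (Fin 2) ℂ) : Matrix (Fin 2) (Fin 2) ℂ)) 0) →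
                deriv (fun t => wilsonAction4 (γ t)) 0 = 0) := by
  intro A₁ hA₁ h111
  obtain ⟨X, hX, hsize, h21, hfib, hEL⟩ := h5EL h47 A₁ hA₁ h111
  refine ⟨X, hX, hsize, ?_, h21, hEL⟩
  -- (20) in the Σ_k form: CHART-Σ's restricted axial `u` + CHART-5's fibre clause
  have hlt : nMax19 F n K U₀ X < e := by
    have h1 : M * (‖A₁‖ + ‖H₁ B‖) ≤ M * (ε₄ + ‖H₁ B‖) := mul_le_mul_of_nonneg_left (by linarith) hM
    exact lt_of_le_of_lt (hsize.trans h1) hMe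
  obtain ⟨u, hu, hax⟩ := hSig X hX hlt
  intro U₁ hU₁
  have hU₁eq : U₁ = expHermField X := by
    funext b
    apply Subtype.ext
    rw [hU₁ b, expHermField_apply, coe_expHerm (hX b)]
  subst hU₁eq
  exact ⟨u, hu, hax, hfib u hu hax⟩

/-! ## §2 The stub text from the chart pieces -/

/-- ★★★ **`stub_existenceMinimalOrbit`'s REGISTERED TEXT FROM THE CHART PIECES** — `stubEX_of_displayedRows` (p599501) at the chart of record (`periodsT3`, `siteEquiv`,
`bgOfCfg`) with its CHART-112 binder DISCHARGED by `hChart_of_pieces` ∘ (`Prop7ChartT3.chart47T3_of_regPr` — [B11] Prop. 3 PROVED at the T³ objects, (46) displayed —,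
`Prop7ChartSigmaT3OfRegPr.chartSigmaT3_of_regPr` — the Σ_k bridge PROVED —, both via `regPr_mono` at the background radius `α L`).  Displayed: N06 ×2 + (46), Prop. 4, (1.37),
the numeric windows (W47)∕(WΣ)∕(WMe), CHART-5+EL, the (γ)-growth input, the Thm 2 torus sockets.  CONDITIONAL — the stub is not closed.
[cite: Balaban1985Variational, Prop. 7 p.299, Prop. 3 p.289, Prop. 5 p.294, Prop. 6 p.295, (141)-(142) p.299; Balaban1985RegularSpaces, Thm 2 p.83, (1.29) p.81, (1.37) p.82] -/
theorem stubEX_of_chartPieces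
    [hFL : ∀ F : T3Family, Fact (0 < (F.L : ℝ))] [hFη : ∀ (F : T3Family) (k : ℕ), Fact (0 < ((F.L : ℝ)⁻¹) ^ k)]
    -- the constants, member-uniform at each `L` (print: «absolute constants depending on d and L only»)
    (B₀ C₄ a₃ α r M CP θ cS : ℕ → ℝ) (hB₀ : ∀ L, 1 < L → 0 < B₀ L) (hC₄ : ∀ L, 1 < L → 0 < C₄ L) (ha₃ : ∀ L, 1 < L → 0 < a₃ L)
    (hα : ∀ L, 1 < L → 0 < α L) (hr : ∀ L, 1 < L → 0 < r L) (hM : ∀ L, 1 < L → 0 < M L) (hCP : ∀ L, 1 < L → 0 < CP L)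
    (hθ : ∀ L, 1 < L → θ L < 1 / 2) (hcS : ∀ L, 1 < L → 0 ≤ cS L)
    -- the curved letters, OPAQUE
    (𝒢f : ∀ (L : ℕ) (i : Idx L) (U₀ : GaugeField (i.1.1.P i.1.2.2) 0 (Matrix.specialUnitaryGroup (Fin 2) ℂ)),
      NegSize (i.1.1.L : ℝ) (((i.1.1.L : ℝ)⁻¹) ^ (i.1.2.2 - i.1.2.1)) (fun _ : Bond 3 (periodsT3 i.1.1 i.1.2.2) => i.1.2.2 - i.1.2.1) 3
          (Matrix (Fin 2) (Fin 2) ℂ) →L[ℂ]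
        Space115 (i.1.1.L : ℝ) (((i.1.1.L : ℝ)⁻¹) ^ (i.1.2.2 - i.1.2.1)) (fun _ : Bond 3 (periodsT3 i.1.1 i.1.2.2) => i.1.2.2 - i.1.2.1)
          (fun _ : Bond 3 (periodsT3 i.1.1 i.1.2.2) × Fin 3 => i.1.2.2 - i.1.2.1) (nabla115 (((i.1.1.L : ℝ)⁻¹) ^ (i.1.2.2 - i.1.2.1)) (bgOfCfg i.1.1 i.1.2.2 U₀)))
    (Wf : ∀ (L : ℕ) (i : Idx L) (U₀ : GaugeField (i.1.1.P i.1.2.2) 0 (Matrix.specialUnitaryGroup (Fin 2) ℂ)),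
      Space115 (i.1.1.L : ℝ) (((i.1.1.L : ℝ)⁻¹) ^ (i.1.2.2 - i.1.2.1)) (fun _ : Bond 3 (periodsT3 i.1.1 i.1.2.2) => i.1.2.2 - i.1.2.1)
          (fun _ : Bond 3 (periodsT3 i.1.1 i.1.2.2) × Fin 3 => i.1.2.2 - i.1.2.1) (nabla115 (((i.1.1.L : ℝ)⁻¹) ^ (i.1.2.2 - i.1.2.1)) (bgOfCfg i.1.1 i.1.2.2 U₀)) →
        NegSize (i.1.1.L : ℝ) (((i.1.1.L : ℝ)⁻¹) ^ (i.1.2.2 - i.1.2.1)) (fun _ : Bond 3 (periodsT3 i.1.1 i.1.2.2) => i.1.2.2 - i.1.2.1) 3 (Matrix (Fin 2) (Fin 2) ℂ))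
    (β : ∀ L : ℕ, Idx L → Type) [∀ (L : ℕ) (i : Idx L), Fintype (β L i)]
    (H₁f : ∀ (L : ℕ) (i : Idx L) (U₀ : GaugeField (i.1.1.P i.1.2.2) 0 (Matrix.specialUnitaryGroup (Fin 2) ℂ)),
      (β L i → Matrix (Fin 2) (Fin 2) ℂ) →L[ℂ]
        Space115 (i.1.1.L : ℝ) (((i.1.1.L : ℝ)⁻¹) ^ (i.1.2.2 - i.1.2.1)) (fun _ : Bond 3 (periodsT3 i.1.1 i.1.2.2) => i.1.2.2 - i.1.2.1)
          (fun _ : Bond 3 (periodsT3 i.1.1 i.1.2.2) × Fin 3 => i.1.2.2 - i.1.2.1) (nabla115 (((i.1.1.L : ℝ)⁻¹) ^ (i.1.2.2 - i.1.2.1)) (bgOfCfg i.1.1 i.1.2.2 U₀)))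
    (Bf : ∀ (L : ℕ) (i : Idx L), GaugeField (i.1.1.P i.1.2.1) 0 (Matrix.specialUnitaryGroup (Fin 2) ℂ) → GaugeField (i.1.1.P i.1.2.2) 0 (Matrix.specialUnitaryGroup (Fin 2) ℂ) →
      β L i → Matrix (Fin 2) (Fin 2) ℂ)
    -- their displayed bounds (the `SectEDatum` fields at admissible backgrounds)
    (norm_G : ∀ (L : ℕ), 1 < L → ∀ (i : Idx L) (ρ : ℝ) (U₀ : GaugeField (i.1.1.P i.1.2.2) 0 (Matrix.specialUnitaryGroup (Fin 2) ℂ)),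
      RegPr i.1.1 i.1.2.1 i.1.2.2 ρ U₀ → ρ ≤ α L → ∀ f, ‖𝒢f L i U₀ f‖ ≤ B₀ L * ‖f‖)
    (prop4 : ∀ (L : ℕ), 1 < L → ∀ (i : Idx L) (ρ : ℝ) (U₀ : GaugeField (i.1.1.P i.1.2.2) 0 (Matrix.specialUnitaryGroup (Fin 2) ℂ)),
      RegPr i.1.1 i.1.2.1 i.1.2.2 ρ U₀ → ρ ≤ α L → QuadAnalytic (Wf L i U₀) (C₄ L) (a₃ L))
    (norm_H₁ : ∀ (L : ℕ), 1 < L → ∀ (i : Idx L) (ρ : ℝ) (U₀ : GaugeField (i.1.1.P i.1.2.2) 0 (Matrix.specialUnitaryGroup (Fin 2) ℂ)),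
      RegPr i.1.1 i.1.2.1 i.1.2.2 ρ U₀ → ρ ≤ α L → ∀ b, ‖H₁f L i U₀ b‖ ≤ B₀ L * ‖b‖)
    (bound20 : ∀ (L : ℕ), 1 < L → ∀ (i : Idx L) (ε₁ : ℝ) (V : GaugeField (i.1.1.P i.1.2.1) 0 (Matrix.specialUnitaryGroup (Fin 2) ℂ))
      (U₀ : GaugeField (i.1.1.P i.1.2.2) 0 (Matrix.specialUnitaryGroup (Fin 2) ℂ)), 0 < ε₁ → PlaqSmall ε₁ V →
      RegPr i.1.1 i.1.2.1 i.1.2.2 ((L : ℝ) ^ 3 * (3 * (L : ℝ)) * ε₁) U₀ → CloseAvg i.1.1 i.1.2.1 i.1.2.2 i.2.2.le ((L : ℝ) ^ 3 * ε₁) V U₀ →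
      ‖Bf L i V U₀‖ < 2 * ((3 : ℝ) * i.1.1.L) * ((L : ℝ) ^ 3 * ε₁))
    -- (46) the letter `H` of Prop. 3's chart (from coarse data on one period of Λ_k to fine torus fields) and its displayed bound ([5] Thm 3.12)
    (BH : ℕ → ℝ) (hBH : ∀ L, 1 < L → 0 ≤ BH L)
    (Hf : ∀ (L : ℕ) (i : Idx L) (U₀ : GaugeField (i.1.1.P i.1.2.2) 0 (Matrix.specialUnitaryGroup (Fin 2) ℂ)),
      (↥(coarseBox i.1.1 i.1.2.1 i.1.2.2) → Matrix (Fin 2) (Fin 2) ℂ) →ₗ[ℂ] (PBond (i.1.1.P i.1.2.2) 0 → Matrix (Fin 2) (Fin 2) ℂ))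
    (hH : ∀ (L : ℕ), 1 < L → ∀ (i : Idx L) (U₀ : GaugeField (i.1.1.P i.1.2.2) 0 (Matrix.specialUnitaryGroup (Fin 2) ℂ)) (X : ↥(coarseBox i.1.1 i.1.2.1 i.1.2.2) → Matrix (Fin 2) (Fin 2) ℂ),
      ‖Hf L i U₀ X‖ ≤ BH L * ‖X‖)
    -- the windows of `Prop7ChartT3.chart47T3_of_regPr` at the background radius `α L` (member-wise `b`, `ε = ε₃` because `L^{K−n}` enters)
    (bf εf : ∀ (L : ℕ), Idx L → ℝ) (hbf : ∀ L, 1 < L → ∀ i, 0 < bf L i) (hεf : ∀ L, 1 < L → ∀ i, 0 < εf L i)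
    (hw47 : ∀ (L : ℕ), 1 < L → ∀ i : Idx L,
      C0 (i.1.1.P i.1.2.2).d * (2 * α L) ≤ 1 / 3 ∧ 4 * (2 * α L) ≤ c2' (i.1.1.P i.1.2.2).d (i.1.1.P i.1.2.2).L ∧
      Real.exp (4 * (800 * ((((i.1.1.P i.1.2.2).d : ℕ) : ℝ) + 1) ^ 2 * ((((i.1.1.P i.1.2.2).d : ℕ) : ℝ) + 4)) * (2 * α L))
        * (1 + 8 * (131072 * ((((i.1.1.P i.1.2.2).d : ℕ) : ℝ) + 1) ^ 2) * ((((i.1.1.P i.1.2.2).L : ℕ) : ℝ) ^ (i.1.2.2 - i.1.2.1) * bf L i)) ≤ 2 ∧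
      4 * ((((i.1.1.P i.1.2.2).L : ℕ) : ℝ) ^ (i.1.2.2 - i.1.2.1) * bf L i) < c3 (i.1.1.P i.1.2.2).d (i.1.1.P i.1.2.2).L ∧
      8 * (i.1.1.P i.1.2.2).d * thetaGen (i.1.1.P i.1.2.2).d (i.1.1.P i.1.2.2).L (2 * α L) * (((i.1.1.P i.1.2.2).L : ℕ) : ℝ)⁻¹ ^ 4 ≤ 1 ∧
      (2 * (((i.1.1.P i.1.2.2).L : ℕ) : ℝ) - 1) * (((i.1.1.P i.1.2.2).L : ℕ) : ℝ)⁻¹ ^ 2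
        + 2 * (i.1.1.P i.1.2.2).d * thetaGen (i.1.1.P i.1.2.2).d (i.1.1.P i.1.2.2).L (2 * α L) * (((i.1.1.P i.1.2.2).L : ℕ) : ℝ)⁻¹ ^ 3
        + 1 / 8 * (1 + 2 * (i.1.1.P i.1.2.2).d * thetaGen (i.1.1.P i.1.2.2).d (i.1.1.P i.1.2.2).L (2 * α L) * (((i.1.1.P i.1.2.2).L : ℕ) : ℝ)⁻¹ ^ 2
          + 2 * (i.1.1.P i.1.2.2).d * C3Gen (i.1.1.P i.1.2.2).d (i.1.1.P i.1.2.2).L * ((((i.1.1.P i.1.2.2).L : ℕ) : ℝ) ^ (i.1.2.2 - i.1.2.1) * bf L i))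
          * (((i.1.1.P i.1.2.2).L : ℕ) : ℝ)⁻¹ ^ 2 ≤ 1 ∧
      18 * C2K i.1.1 i.1.2.1 i.1.2.2 (α L) * BH L * (i.1.1.P i.1.2.2).d * 1 * εf L i ≤ 1 ∧ 2 * εf L i ≤ bf L i / 2)
    -- the windows of `Prop7ChartSigmaT3OfRegPr.chartSigmaT3_of_regPr` at `(ε₀, e) := (α L, e L)`
    (ef : ℕ → ℝ) (hef : ∀ L, 1 < L → 0 < ef L)
    (hwS : ∀ (L : ℕ), 1 < L → ∀ i : Idx L,
      C0 (i.1.1.P i.1.2.2).d * (2 * α L) ≤ 1 / 3 ∧ 4 * (2 * α L) ≤ c2' (i.1.1.P i.1.2.2).d (i.1.1.P i.1.2.2).L ∧ 2 * α L ≤ 1 / 8 ∧ ef L ≤ 1 / 20 ∧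
      Real.exp (4 * (800 * ((((i.1.1.P i.1.2.2).d : ℕ) : ℝ) + 1) ^ 2 * ((((i.1.1.P i.1.2.2).d : ℕ) : ℝ) + 4)) * (2 * α L))
        * (1 + 8 * (131072 * ((((i.1.1.P i.1.2.2).d : ℕ) : ℝ) + 1) ^ 2) * ef L) ≤ 2 ∧
      2 * ef L ≤ c3 (i.1.1.P i.1.2.2).d (i.1.1.P i.1.2.2).L ∧ 2048 * (((i.1.1.P i.1.2.2).d : ℕ) : ℝ) * ef L ≤ 1 ∧
      C0 (i.1.1.P i.1.2.2).d * (2 * α L + 4 * ef L) ≤ 1 / 3 ∧ 2 * (2 * α L + 4 * ef L) ≤ c2' (i.1.1.P i.1.2.2).d (i.1.1.P i.1.2.2).L)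
    -- the size window linking CHART-5's size row to CHART-Σ's radius
    (hMe : ∀ L, 1 < L → M L * (r L + 2 * B₀ L * α L) < ef L)
    -- (CH-5+EL) Prop. 5's composite (112) + (123)–(140) + the fibre ∕ PIN junction + E–L criticality, DISPLAYED (★w1's `Chart5T3` text with the EL conjunct the owner ruled in)
    (h5EL : ∀ (L : ℕ), 1 < L → ∀ (i : Idx L) (ε₁ : ℝ) (V : GaugeField (i.1.1.P i.1.2.1) 0 (Matrix.specialUnitaryGroup (Fin 2) ℂ))
      (U₀ : GaugeField (i.1.1.P i.1.2.2) 0 (Matrix.specialUnitaryGroup (Fin 2) ℂ)), 0 < ε₁ → PlaqSmall ε₁ V →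
      RegPr i.1.1 i.1.2.1 i.1.2.2 ((L : ℝ) ^ 3 * (3 * (L : ℝ)) * ε₁) U₀ → CloseAvg i.1.1 i.1.2.1 i.1.2.2 i.2.2.le ((L : ℝ) ^ 3 * ε₁) V U₀ → (L : ℝ) ^ 3 * (3 * (L : ℝ)) * ε₁ ≤ α L →
      Chart47T3 i.1.1 i.1.2.1 i.1.2.2 (α L) (εf L i) U₀ (Hf L i U₀) →
      ∀ A₁ : Space115 (i.1.1.L : ℝ) (((i.1.1.L : ℝ)⁻¹) ^ (i.1.2.2 - i.1.2.1)) (fun _ : Bond 3 (periodsT3 i.1.1 i.1.2.2) => i.1.2.2 - i.1.2.1)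
          (fun _ : Bond 3 (periodsT3 i.1.1 i.1.2.2) × Fin 3 => i.1.2.2 - i.1.2.1) (nabla115 (((i.1.1.L : ℝ)⁻¹) ^ (i.1.2.2 - i.1.2.1)) (bgOfCfg i.1.1 i.1.2.2 U₀)),
        ‖A₁‖ < r L → A₁ + 𝒢f L i U₀ (Jcur (bgOfCfg i.1.1 i.1.2.2 U₀)) + 𝒢f L i U₀ (Wf L i U₀ (A₁ + H₁f L i U₀ (Bf L i V U₀))) = 0 →
        ∃ X : PBond (i.1.1.P i.1.2.2) 0 → Matrix (Fin 2) (Fin 2) ℂ,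
          (∀ b : PBond (i.1.1.P i.1.2.2) 0, (X b).IsHermitian ∧ Matrix.trace (X b) = 0) ∧
          nMax19 i.1.1 i.1.2.1 i.1.2.2 U₀ X ≤ M L * (‖A₁‖ + ‖H₁f L i U₀ (Bf L i V U₀)‖) ∧ IsLandauPrint i.1.1 i.1.2.1 i.1.2.2 U₀ X ∧
          (∀ u : GaugeTransf (i.1.1.P i.1.2.2) 0 (Matrix.specialUnitaryGroup (Fin 2) ℂ), RestrictedPrint i.1.1 i.1.2.1 i.1.2.2 U₀ u →
            IsAxialPrint i.1.1 i.1.2.1 i.1.2.2 U₀ (GaugeField.gaugeAct u (emb15 U₀ (expHermField X))) →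
              GaugeField.gaugeAct u (emb15 U₀ (expHermField X)) ∈ fibre i.1.1 ℰp i.1.2.1 i.1.2.2 i.2.2.le V) ∧
          (∀ u : GaugeTransf (i.1.1.P i.1.2.2) 0 (Matrix.specialUnitaryGroup (Fin 2) ℂ), RestrictedPrint i.1.1 i.1.2.1 i.1.2.2 U₀ u →
            GaugeField.gaugeAct u (emb15 U₀ (expHermField X)) ∈ fibre i.1.1 ℰp i.1.2.1 i.1.2.2 i.2.2.le V →
            ∀ γ : ℝ → GaugeField (i.1.1.P i.1.2.2) 0 (Matrix.specialUnitaryGroup (Fin 2) ℂ), γ 0 = GaugeField.gaugeAct u (emb15 U₀ (expHermField X)) →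
              (∀ t, γ t ∈ fibre i.1.1 ℰp i.1.2.1 i.1.2.2 i.2.2.le V) →
              (∀ b, DifferentiableAt ℝ (fun t => ((γ t b : Matrix.specialUnitaryGroup (Fin 2) ℂ) : Matrix (Fin 2) (Fin 2) ℂ)) 0) →
                deriv (fun t => wilsonAction4 (γ t)) 0 = 0))
    -- (ii) the (γ)-input of ★w4's `growth142_T3`, displayed member-uniformly
    (hGrowth : ∀ (L : ℕ), 1 < L → ∀ (i : Idx L) (ε₁ ε₄ : ℝ) (V : GaugeField (i.1.1.P i.1.2.1) 0 (Matrix.specialUnitaryGroup (Fin 2) ℂ))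
      (U₀ : GaugeField (i.1.1.P i.1.2.2) 0 (Matrix.specialUnitaryGroup (Fin 2) ℂ)) (X : PBond (i.1.1.P i.1.2.2) 0 → Matrix (Fin 2) (Fin 2) ℂ)
      (u : GaugeTransf (i.1.1.P i.1.2.2) 0 (Matrix.specialUnitaryGroup (Fin 2) ℂ)) (W : GaugeField (i.1.1.P i.1.2.2) 0 (Matrix.specialUnitaryGroup (Fin 2) ℂ)),
      0 < ε₁ → ε₄ ≤ 1 / 4 → (L : ℝ) ^ 3 * (3 * (L : ℝ)) * ε₁ ≤ ε₄ → PlaqSmall ε₁ V → RegPr i.1.1 i.1.2.1 i.1.2.2 ((L : ℝ) ^ 3 * (3 * (L : ℝ)) * ε₁) U₀ →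
      CloseAvg i.1.1 i.1.2.1 i.1.2.2 i.2.2.le ((L : ℝ) ^ 3 * ε₁) V U₀ → (∀ b : PBond (i.1.1.P i.1.2.2) 0, (X b).IsHermitian ∧ Matrix.trace (X b) = 0) →
      nMax19 i.1.1 i.1.2.1 i.1.2.2 U₀ X < ε₄ → AvgCondPrint i.1.1 i.1.2.1 i.1.2.2 i.2.2.le V U₀ X → IsLandauPrint i.1.1 i.1.2.1 i.1.2.2 U₀ X →
      RestrictedPrint i.1.1 i.1.2.1 i.1.2.2 U₀ u → W = GaugeField.gaugeAct u (emb15 U₀ (expHermField X)) → IsAxialPrint i.1.1 i.1.2.1 i.1.2.2 U₀ W →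
      W ∈ fibre i.1.1 ℰp i.1.2.1 i.1.2.2 i.2.2.le V →
      (∀ γ : ℝ → GaugeField (i.1.1.P i.1.2.2) 0 (Matrix.specialUnitaryGroup (Fin 2) ℂ), γ 0 = W → (∀ t, γ t ∈ fibre i.1.1 ℰp i.1.2.1 i.1.2.2 i.2.2.le V) →
        (∀ b, DifferentiableAt ℝ (fun t => ((γ t b : Matrix.specialUnitaryGroup (Fin 2) ℂ) : Matrix (Fin 2) (Fin 2) ℂ)) 0) →
          deriv (fun t => wilsonAction4 (γ t)) 0 = 0) →
      ∀ W' : GaugeField (i.1.1.P i.1.2.2) 0 (Matrix.specialUnitaryGroup (Fin 2) ℂ), W' ∈ regFibrePr i.1.1 i.1.2.1 i.1.2.2 i.2.2.le (178 * ε₄) V →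
        ∃ g : GaugeTransf (i.1.1.P i.1.2.2) 0 (Matrix.specialUnitaryGroup (Fin 2) ℂ), descTransf i.1.1 i.1.2.1 i.1.2.2 i.2.2.le g = (fun _ => 1) ∧
          (∑ b : PBond (i.1.1.P i.1.2.2) 0, ‖pertVar W (GaugeField.gaugeAct g W') b‖ ^ 2 ≤
            CP L * ((i.1.1.L : ℝ) ^ (i.1.2.2 - i.1.2.1)) ^ 2 * ∑ p : Plaq (i.1.1.P i.1.2.2) 0,
              ‖((GaugeField.plaqHol (GaugeField.gaugeAct g W') p : Matrix.specialUnitaryGroup (Fin 2) ℂ) : Matrix (Fin 2) (Fin 2) ℂ)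
                  * star ((GaugeField.plaqHol W p : Matrix.specialUnitaryGroup (Fin 2) ℂ) : Matrix (Fin 2) (Fin 2) ℂ) - 1‖ ^ 2) ∧
          (-(θ L * ∑ p : Plaq (i.1.1.P i.1.2.2) 0,
              ‖((GaugeField.plaqHol (GaugeField.gaugeAct g W') p : Matrix.specialUnitaryGroup (Fin 2) ℂ) : Matrix (Fin 2) (Fin 2) ℂ)
                  * star ((GaugeField.plaqHol W p : Matrix.specialUnitaryGroup (Fin 2) ℂ) : Matrix (Fin 2) (Fin 2) ℂ) - 1‖ ^ 2) -
              (cS L * ε₄ * (((i.1.1.L : ℝ) ^ (i.1.2.2 - i.1.2.1)) ^ 2)⁻¹) * ∑ b : PBond (i.1.1.P i.1.2.2) 0, ‖pertVar W (GaugeField.gaugeAct g W') b‖ ^ 2 ≤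
            ∑ p : Plaq (i.1.1.P i.1.2.2) 0, (1 / 2) * ((((((GaugeField.plaqHol W p : Matrix.specialUnitaryGroup (Fin 2) ℂ) : Matrix (Fin 2) (Fin 2) ℂ)) - 1)ᴴ
              * (((((GaugeField.gaugeAct g W' ⟨p.src, p.μ⟩ : Matrix.specialUnitaryGroup (Fin 2) ℂ) : Matrix (Fin 2) (Fin 2) ℂ) * star (W ⟨p.src, p.μ⟩ : Matrix (Fin 2) (Fin 2) ℂ) - 1)
                  + (W ⟨p.src, p.μ⟩ : Matrix (Fin 2) (Fin 2) ℂ)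
                      * (((GaugeField.gaugeAct g W' ⟨p.src.shift p.μ, p.ν⟩ : Matrix.specialUnitaryGroup (Fin 2) ℂ) : Matrix (Fin 2) (Fin 2) ℂ) *
                          star (W ⟨p.src.shift p.μ, p.ν⟩ : Matrix (Fin 2) (Fin 2) ℂ) - 1)
                      * star (W ⟨p.src, p.μ⟩ : Matrix (Fin 2) (Fin 2) ℂ)
                  - ((W ⟨p.src, p.μ⟩ * W ⟨p.src.shift p.μ, p.ν⟩ * (W ⟨p.src.shift p.ν, p.μ⟩)⁻¹ : Matrix.specialUnitaryGroup (Fin 2) ℂ) :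
                        Matrix (Fin 2) (Fin 2) ℂ)
                      * (((GaugeField.gaugeAct g W' ⟨p.src.shift p.ν, p.μ⟩ : Matrix.specialUnitaryGroup (Fin 2) ℂ) : Matrix (Fin 2) (Fin 2) ℂ) *
                          star (W ⟨p.src.shift p.ν, p.μ⟩ : Matrix (Fin 2) (Fin 2) ℂ) - 1)
                      * star ((W ⟨p.src, p.μ⟩ * W ⟨p.src.shift p.μ, p.ν⟩ * (W ⟨p.src.shift p.ν, p.μ⟩)⁻¹ : Matrix.specialUnitaryGroup (Fin 2) ℂ) :
                        Matrix (Fin 2) (Fin 2) ℂ)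
                  - ((GaugeField.plaqHol W p : Matrix.specialUnitaryGroup (Fin 2) ℂ) : Matrix (Fin 2) (Fin 2) ℂ)
                      * (((GaugeField.gaugeAct g W' ⟨p.src, p.ν⟩ : Matrix.specialUnitaryGroup (Fin 2) ℂ) : Matrix (Fin 2) (Fin 2) ℂ) * star (W ⟨p.src, p.ν⟩ : Matrix (Fin 2) (Fin 2) ℂ) - 1)
                      * star ((GaugeField.plaqHol W p : Matrix.specialUnitaryGroup (Fin 2) ℂ) : Matrix (Fin 2) (Fin 2) ℂ))
                * ((GaugeField.plaqHol W p : Matrix.specialUnitaryGroup (Fin 2) ℂ) : Matrix (Fin 2) (Fin 2) ℂ))).trace).re))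
    -- (T2) the [B8] Thm 2 torus sockets, one `(B₁, c₁)` per `L`
    (hThm2 : ∀ (L : ℕ), 1 < L → ∃ B₁ c₁ : ℝ, 0 < B₁ ∧ 0 < c₁ ∧ ∀ (F : T3Family), F.L = L → ∀ (n K : ℕ), n < K →
      ∃ (β₀ B₂ : ℝ) (len : B7Prop1Explicit.Site (F.P K).d → ℝ),
        Thm2TorusAt (F.P K).L (K - n) ((((F.P K).sitesPerDir 0 : ℕ) : ℤ)) (eta F n K) β₀ B₁ B₂ c₁ len (specialUnitaryUnits (Fin 2)) (fun _ => True)) :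
    ∀ (L : ℕ), 1 < L → ∀ (B₃ : ℝ), 4 < B₃ → ∃ a₁' O₁ : ℝ, 0 < a₁' ∧ 1 ≤ O₁ ∧
    ∀ (F : T3Family), F.L = L → ∀ (n K : ℕ) (hnK : n < K) (ε₁ : ℝ), 0 < ε₁ →
      ∀ V : GaugeField (F.P n) 0 (Matrix.specialUnitaryGroup (Fin 2) ℂ), PlaqSmall ε₁ V →
        ∀ U₀ : GaugeField (F.P K) 0 (Matrix.specialUnitaryGroup (Fin 2) ℂ), RegPr F n K ((L : ℝ) ^ 3 * B₃ * ε₁) U₀ → U₀ ∈ fibre F ℰp n K hnK.le V →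
          ε₁ ≤ a₁' → ∃ U ∈ regFibrePr F n K hnK.le (O₁ * (L : ℝ) ^ 3 * B₃ * ε₁) V,
            IsMinOn (fun W : GaugeField (F.P K) 0 (Matrix.specialUnitaryGroup (Fin 2) ℂ) => wilsonAction4 W)
              (regFibrePr F n K hnK.le (O₁ * (L : ℝ) ^ 3 * B₃ * ε₁) V) U := by
  -- the CHART-112 binder of `stubEX_of_displayedRows` at the chart of record, from the pieces
  refine stubEX_of_displayedRows (fun L i => periodsT3 i.1.1 i.1.2.2) (fun L i => siteEquiv i.1.1 i.1.2.2) (fun L i x μ => siteEquiv_shiftEquiv i.1.1 i.1.2.2 x μ)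
    B₀ C₄ a₃ α r M CP θ cS hB₀ hC₄ ha₃ hα hr hM hCP hθ hcS 𝒢f Wf β H₁f Bf norm_G prop4 norm_H₁ bound20 ?_ hGrowth hThm2
  intro L hL i ε₁ V U₀ hε₁ hV hreg hclose hαe A₁ hA₁ hsol
  have hFL' : (i.1.1.L : ℝ) = (L : ℝ) := by exact_mod_cast i.2.1
  have hL0 : (0 : ℝ) < (L : ℝ) := by exact_mod_cast (show 0 < L by omega)
  obtain ⟨w1, w2, w3, w4, w5, w6, w7, w8⟩ := hw47 L hL i
  obtain ⟨s1, s2, s3, s4, s5, s6, s7, s8, s9⟩ := hwS L hL i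
  -- the background at the window radius `α L`
  have hregα : RegPr i.1.1 i.1.2.1 i.1.2.2 (α L) U₀ := regPr_mono i.1.1 hαe hreg
  -- CHART-47 (PROVED, (46) displayed) and CHART-Σ (PROVED)
  have h47 : Chart47T3 i.1.1 i.1.2.1 i.1.2.2 (α L) (εf L i) U₀ (Hf L i U₀) :=
    chart47T3_of_regPr i.1.1 i.1.2.1 i.1.2.2 i.2.2 (hα L hL) (hbf L hL i) (hεf L hL i) (hBH L hL) U₀ hregα w1 w2 w3 w4 w5 w6 w7 w8 (Hf L i U₀) (hH L hL i U₀)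
  have hSig : ChartSigmaT3 i.1.1 i.1.2.1 i.1.2.2 (ef L) U₀ :=
    chartSigmaT3_of_regPr i.1.1 (hα L hL) (hef L hL) s1 s2 s3 s4 s5 s6 s7 s8 s9 U₀ hregα
  -- ‖H₁B‖ ≤ 2B₀α from `norm_H₁` ∘ `bound20` and `L³·3L·ε₁ ≤ α`
  have hB := bound20 L hL i ε₁ V U₀ hε₁ hV hreg hclose
  have hH₁B : ‖H₁f L i U₀ (Bf L i V U₀)‖ ≤ 2 * B₀ L * α L := by
    have h0 := norm_H₁ L hL i _ U₀ hreg hαe (Bf L i V U₀)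
    have hB' : ‖Bf L i V U₀‖ ≤ 2 * α L := by
      have h3 : 2 * ((3 : ℝ) * i.1.1.L) * ((L : ℝ) ^ 3 * ε₁) = 2 * ((L : ℝ) ^ 3 * (3 * (L : ℝ)) * ε₁) := by rw [hFL']; ring
      rw [h3] at hB
      linarith
    calc ‖H₁f L i U₀ (Bf L i V U₀)‖ ≤ B₀ L * ‖Bf L i V U₀‖ := h0
      _ ≤ B₀ L * (2 * α L) := mul_le_mul_of_nonneg_left hB' (hB₀ L hL).le
      _ = 2 * B₀ L * α L := by ring
  have hMe' : M L * (r L + ‖H₁f L i U₀ (Bf L i V U₀)‖) < ef L := by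
    have : M L * (r L + ‖H₁f L i U₀ (Bf L i V U₀)‖) ≤ M L * (r L + 2 * B₀ L * α L) := mul_le_mul_of_nonneg_left (by linarith) (hM L hL).le
    exact lt_of_le_of_lt this (hMe L hL)
  exact hChart_of_pieces i.1.1 i.2.2.le h47 hSig (h5EL L hL i ε₁ V U₀ hε₁ hV hreg hclose hαe) (hM L hL).le hMe' A₁ hA₁ hsol

end Summit.QuantumFields.YangMills.Theorems.Prop7StubEXOfChartPieces

end
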